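import Literature.Geometry.Lorentzian.KerrSchildEnergyEstimate

/-!
# Route ClusterCompleteness — crux `AdiabaticMultiKerrILED`, line `Sketch`:
# slab-integral bookkeeping for the non-degenerate ILED assembly

Helper file for the crux `stmt-FinalStateConjecture-14310`
(`Summit.FinalStateConjecture.FinalStateConjecture.Theses.ClusterCompleteness.AdiabaticMultiKerrILED`),
line `Sketch` (lead c7, wave 9): elementary bookkeeping for iterated Lebesgue integrals over a
slab `(0, s] × S` in the leaf parametrisation (monotonicity, additivity, constants, unions,
measurability of the inner integral), the measurability of norm shells in `ℝ³`, and two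
real-arithmetic cores of the photon-sphere assembly `restFrame_ILED_photonSphere`.
Registered anchor: `slab_lintegral_add_left`. [folklore]
-/

noncomputable section

-- the doubled `FinalStateConjecture.FinalStateConjecture` path component trips dupNamespace
set_option linter.dupNamespace false

open Set MeasureTheory
open scoped ENNReal
open Literature.Geometry.Lorentzian

namespace Summit.FinalStateConjecture.FinalStateConjecture.Theorems

/-- Monotonicity of a slab integral in the integrand on a measurable set. [folklore] -/
theorem slab_lintegral_mono_fun {s : ℝ} {S : Set E3} {f g : ℝ → E3 → ℝ≥0∞}
    (hS : MeasurableSet S) (hfg : ∀ u, ∀ y ∈ S, f u y ≤ g u y) :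
    ∫⁻ u in Set.Ioc 0 s, ∫⁻ y in S, f u y ≤ ∫⁻ u in Set.Ioc 0 s, ∫⁻ y in S, g u y :=
  lintegral_mono fun u ↦ setLIntegral_mono' hS (hfg u)

/-- Monotonicity of a slab integral in the set. [folklore] -/
theorem slab_lintegral_mono_set {s : ℝ} {A B : Set E3} (f : ℝ → E3 → ℝ≥0∞) (hAB : A ⊆ B) :
    ∫⁻ u in Set.Ioc 0 s, ∫⁻ y in A, f u y ≤ ∫⁻ u in Set.Ioc 0 s, ∫⁻ y in B, f u y :=
  lintegral_mono fun _ ↦ lintegral_mono_set hAB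

/-- The inner set integral of a jointly measurable integrand is measurable in the slab
parameter (Tonelli). [folklore] -/
theorem measurable_slab_inner {S : Set E3} {f : ℝ → E3 → ℝ≥0∞}
    (hf : Measurable (Function.uncurry f)) : Measurable fun u ↦ ∫⁻ y in S, f u y :=
  hf.lintegral_prod_right' (ν := volume.restrict S)

/-- **Additivity of slab integrals** (registered anchor `slab_lintegral_add_left`): if the first
integrand is jointly measurable, the slab integral of a sum is the sum of the slab integrals.
[folklore] -/
theorem slab_lintegral_add_left : ∀ (s : ℝ) (S : Set E3) (f g : ℝ → E3 → ℝ≥0∞), Measurable (Function.uncurry f) → (∫⁻ u in Set.Ioc 0 s, ∫⁻ y in S, (f u y + g u y)) = (∫⁻ u in Set.Ioc 0 s, ∫⁻ y in S, f u y) + ∫⁻ u in Set.Ioc 0 s, ∫⁻ y in S, g u y := by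
  intro s S f g hf
  have hin : ∀ u, ∫⁻ y in S, (f u y + g u y) = (∫⁻ y in S, f u y) + ∫⁻ y in S, g u y :=
    fun u ↦ lintegral_add_left (hf.comp measurable_prodMk_left) _
  simp only [hin]
  exact lintegral_add_left (measurable_slab_inner hf) _

/-- Additivity of slab integrals, second integrand measurable. [folklore] -/
theorem slab_lintegral_add_right {s : ℝ} {S : Set E3} (f : ℝ → E3 → ℝ≥0∞) {g : ℝ → E3 → ℝ≥0∞}
    (hg : Measurable (Function.uncurry g)) :
    (∫⁻ u in Set.Ioc 0 s, ∫⁻ y in S, (f u y + g u y)) =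
      (∫⁻ u in Set.Ioc 0 s, ∫⁻ y in S, f u y) + ∫⁻ u in Set.Ioc 0 s, ∫⁻ y in S, g u y := by
  have hin : ∀ u, ∫⁻ y in S, (f u y + g u y) = (∫⁻ y in S, f u y) + ∫⁻ y in S, g u y :=
    fun u ↦ lintegral_add_right' _ (hg.comp measurable_prodMk_left).aemeasurable
  simp only [hin]
  exact lintegral_add_right' _ (measurable_slab_inner hg).aemeasurable

/-- Constants come out of slab integrals. [folklore] -/
theorem slab_lintegral_const_mul {s : ℝ} {S : Set E3} (f : ℝ → E3 → ℝ≥0∞) {c : ℝ≥0∞}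
    (hc : c ≠ ⊤) :
    (∫⁻ u in Set.Ioc 0 s, ∫⁻ y in S, c * f u y) = c * ∫⁻ u in Set.Ioc 0 s, ∫⁻ y in S, f u y := by
  have hin : ∀ u, ∫⁻ y in S, c * f u y = c * ∫⁻ y in S, f u y :=
    fun _ ↦ lintegral_const_mul' c _ hc
  simp only [hin]
  exact lintegral_const_mul' c _ hc

/-- Subadditivity of slab integrals over a union of sets. [folklore] -/
theorem slab_lintegral_union_le {s : ℝ} (A B : Set E3) {f : ℝ → E3 → ℝ≥0∞}
    (hf : Measurable (Function.uncurry f)) :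
    ∫⁻ u in Set.Ioc 0 s, ∫⁻ y in A ∪ B, f u y ≤
      (∫⁻ u in Set.Ioc 0 s, ∫⁻ y in A, f u y) + ∫⁻ u in Set.Ioc 0 s, ∫⁻ y in B, f u y :=
  calc ∫⁻ u in Set.Ioc 0 s, ∫⁻ y in A ∪ B, f u y
      ≤ ∫⁻ u in Set.Ioc 0 s, ((∫⁻ y in A, f u y) + ∫⁻ y in B, f u y) :=
        lintegral_mono fun _ ↦ lintegral_union_le _ A B
    _ = (∫⁻ u in Set.Ioc 0 s, ∫⁻ y in A, f u y) + ∫⁻ u in Set.Ioc 0 s, ∫⁻ y in B, f u y :=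
        lintegral_add_left (measurable_slab_inner hf) _

/-- Norm shells `{a ≤ ‖y‖ ≤ b}` in `ℝ³` are measurable. [folklore] -/
theorem measurableSet_norm_Icc (a b : ℝ) : MeasurableSet {y : E3 | a ≤ ‖y‖ ∧ ‖y‖ ≤ b} :=
  (isClosed_le continuous_const continuous_norm).measurableSet.inter
    (isClosed_le continuous_norm continuous_const).measurableSet

/-- Norm shells `{a < ‖y‖ ≤ b}` in `ℝ³` are measurable. [folklore] -/
theorem measurableSet_norm_Ioc (a b : ℝ) : MeasurableSet {y : E3 | a < ‖y‖ ∧ ‖y‖ ≤ b} :=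
  (isOpen_lt continuous_const continuous_norm).measurableSet.inter
    (isClosed_le continuous_norm continuous_const).measurableSet

/-- Norm shells `{a < ‖y‖ < b}` in `ℝ³` are measurable. [folklore] -/
theorem measurableSet_norm_Ioo (a b : ℝ) : MeasurableSet {y : E3 | a < ‖y‖ ∧ ‖y‖ < b} :=
  (isOpen_lt continuous_const continuous_norm).measurableSet.inter
    (isOpen_lt continuous_norm continuous_const).measurableSet

/-- Exterior regions `{a < ‖y‖}` in `ℝ³` are measurable. [folklore] -/
theorem measurableSet_norm_Ioi (a : ℝ) : MeasurableSet {y : E3 | a < ‖y‖} :=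
  (isOpen_lt continuous_const continuous_norm).measurableSet

/-- Two-sided norm shells with a disjunction (union of two closed shells). [folklore] -/
theorem measurableSet_norm_Icc_union (a b c d : ℝ) :
    MeasurableSet {y : E3 | (a ≤ ‖y‖ ∧ ‖y‖ ≤ b) ∨ (c ≤ ‖y‖ ∧ ‖y‖ ≤ d)} :=
  (measurableSet_norm_Icc a b).union (measurableSet_norm_Icc c d)

/-- Real-arithmetic core of the photon-sphere energy split: with `q = S/r`,
`w = (1 − μ) q + μ T` and `1 − μ ≥ 1/5` one has `q² ≤ 50 T² + 50 w²`, whence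
`T² + A ≤ 51 T² + (A − q²) + 50 w²`. [folklore] -/
theorem photonSphere_energy_split_real {M r T S A mu : ℝ} (h1 : 5 * M / 2 ≤ r) (h2 : 0 < r)
    (hmu0 : 0 ≤ mu) (hmu : mu ≤ 2 * M / r) :
    T ^ 2 + A ≤ 51 * T ^ 2 + (A - (S / r) ^ 2) + 50 * ((1 - mu) * S / r + mu * T) ^ 2 := by
  have hmu1 : mu ≤ 4 / 5 := by
    refine hmu.trans ?_
    rw [div_le_iff₀ h2]
    linarith
  set q : ℝ := S / r with hq
  have hw : (1 - mu) * S / r + mu * T = (1 - mu) * q + mu * T := by rw [hq]; ring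
  rw [hw]
  have h15 : 1 / 5 ≤ 1 - mu := by linarith
  have hA1 : ((1 - mu) * q) ^ 2 ≤ 2 * ((1 - mu) * q + mu * T) ^ 2 + 2 * (mu * T) ^ 2 := by
    nlinarith [sq_nonneg ((1 - mu) * q + 2 * mu * T)]
  have hmusq : mu ^ 2 ≤ 1 := by nlinarith
  have hA2 : (mu * T) ^ 2 ≤ T ^ 2 := by nlinarith [sq_nonneg T]
  have h25 : 1 ≤ 25 * (1 - mu) ^ 2 := by nlinarith
  have hA3 : q ^ 2 ≤ 25 * ((1 - mu) * q) ^ 2 := by nlinarith [sq_nonneg q]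
  nlinarith [sq_nonneg q]

/-- `M² a + c ≤ K_P (M² + M³) B` from `a ≤ K_P B` and `c ≤ K_P M³ B`. [folklore] -/
theorem commutedBulk_real {M KP a c B : ℝ} (ha : a ≤ KP * B) (hc : c ≤ KP * M ^ 3 * B) :
    M ^ 2 * a + c ≤ KP * (M ^ 2 + M ^ 3) * B := by
  have hM2 : 0 ≤ M ^ 2 := by positivity
  nlinarith [mul_le_mul_of_nonneg_left ha hM2]

/-- The shell geometry of the photon-sphere assembly: inclusions between the norm shells
`PS = [5M/2, 7M/2]`, `SH = [9M/4, 15M/4]`, `SHL` (the two side shells), `Ω = (2M, ∞)`,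
`Ω9 = (2M, 9M]`, `Z = (2M, 15M/2]`, `FAR = [15M/2, 9M]`, `COL = (2M, 2M + η)`, the off-photon-sphere
region `OFF`, the decomposition `SH = PS ∪ SHL` and the cover `Ω9 ⊆ COL ∪ (OFF ∪ PS)`
(`0 < η ≤ M/4`). [folklore] -/
theorem photonSphere_shells : ∀ (M η : ℝ), 0 < M → 0 < η → η ≤ M / 4 → {y : E3 | 5 * M / 2 ≤ ‖y‖ ∧ ‖y‖ ≤ 7 * M / 2} ⊆ {y : E3 | 2 * M < ‖y‖} ∧ {y : E3 | 5 * M / 2 ≤ ‖y‖ ∧ ‖y‖ ≤ 7 * M / 2} ⊆ {y : E3 | 2 * M < ‖y‖ ∧ ‖y‖ ≤ 9 * M} ∧ {y : E3 | 9 * M / 4 ≤ ‖y‖ ∧ ‖y‖ ≤ 15 * M / 4} ⊆ {y : E3 | 2 * M < ‖y‖} ∧ {y : E3 | 9 * M / 4 ≤ ‖y‖ ∧ ‖y‖ ≤ 15 * M / 4} ⊆ {y : E3 | 2 * M < ‖y‖ ∧ ‖y‖ ≤ 9 * M} ∧ {y : E3 | 9 * M / 4 ≤ ‖y‖ ∧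 ‖y‖ ≤ 15 * M / 4} ⊆ {y : E3 | 2 * M < ‖y‖ ∧ ‖y‖ ≤ 15 * M / 2} ∧ {y : E3 | 15 * M / 2 ≤ ‖y‖ ∧ ‖y‖ ≤ 9 * M} ⊆ {y : E3 | 2 * M < ‖y‖} ∧ {y : E3 | 2 * M + η ≤ ‖y‖ ∧ ‖y‖ ≤ 9 * M ∧ (‖y‖ ≤ 5 * M / 2 ∨ 7 * M / 2 ≤ ‖y‖)} ⊆ {y : E3 | 2 * M < ‖y‖} ∧ {y : E3 | (9 * M / 4 ≤ ‖y‖ ∧ ‖y‖ ≤ 5 * M / 2) ∨ (7 * M / 2 ≤ ‖y‖ ∧ ‖y‖ ≤ 15 * M / 4)} ⊆ {y : E3 | 2 * M + η ≤ ‖y‖ ∧ ‖y‖ ≤ 9 * M ∧ (‖y‖ ≤ 5 * M / 2 ∨ 7 * M / 2 ≤ ‖y‖)} ∧ {y : E3 | 2 * M < ‖y‖ ∧ ‖y‖ ≤ 9 * M} ⊆ {y : E3 | 2 * M < ‖y‖} ∧ {y : E3 | 9 * M / 4 ≤ ‖y‖ ∧ ‖y‖ ≤ 15 * M / 4} = {y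 : E3 | 5 * M / 2 ≤ ‖y‖ ∧ ‖y‖ ≤ 7 * M / 2} ∪ {y : E3 | (9 * M / 4 ≤ ‖y‖ ∧ ‖y‖ ≤ 5 * M / 2) ∨ (7 * M / 2 ≤ ‖y‖ ∧ ‖y‖ ≤ 15 * M / 4)} ∧ {y : E3 | 2 * M < ‖y‖ ∧ ‖y‖ ≤ 9 * M} ⊆ {y : E3 | 2 * M < ‖y‖ ∧ ‖y‖ < 2 * M + η} ∪ ({y : E3 | 2 * M + η ≤ ‖y‖ ∧ ‖y‖ ≤ 9 * M ∧ (‖y‖ ≤ 5 * M / 2 ∨ 7 * M / 2 ≤ ‖y‖)} ∪ {y : E3 | 5 * M / 2 ≤ ‖y‖ ∧ ‖y‖ ≤ 7 * M / 2}) := by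
  intro M η hM hη hη4
  have hM94 : 2 * M < 9 * M / 4 := by linarith only [hM]
  have hη94 : 2 * M + η ≤ 9 * M / 4 := by linarith only [hη4, hM]
  refine ⟨fun y hy ↦ ?_, fun y hy ↦ ?_, fun y hy ↦ ?_, fun y hy ↦ ?_, fun y hy ↦ ?_, fun y hy ↦ ?_,
    fun y hy ↦ ?_, fun y hy ↦ ?_, fun y hy ↦ ?_, ?_, ?_⟩
  · simp only [Set.mem_setOf_eq] at hy ⊢; linarith [hy.1]
  · simp only [Set.mem_setOf_eq] at hy ⊢; constructor <;> linarith [hy.1, hy.2]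
  · simp only [Set.mem_setOf_eq] at hy ⊢; linarith [hy.1]
  · simp only [Set.mem_setOf_eq] at hy ⊢; constructor <;> linarith [hy.1, hy.2]
  · simp only [Set.mem_setOf_eq] at hy ⊢; constructor <;> linarith [hy.1, hy.2]
  · simp only [Set.mem_setOf_eq] at hy ⊢; linarith [hy.1]
  · simp only [Set.mem_setOf_eq] at hy ⊢; linarith [hy.1]
  · simp only [Set.mem_setOf_eq] at hy ⊢
    rcases hy with ⟨h1, h2⟩ | ⟨h1, h2⟩
    · exact ⟨by linarith, by linarith, Or.inl h2⟩
    · exact ⟨by linarith, by linarith, Or.inr h1⟩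
  · simp only [Set.mem_setOf_eq] at hy ⊢; exact hy.1
  · ext y
    simp only [Set.mem_union, Set.mem_setOf_eq]
    constructor
    · rintro ⟨h1, h2⟩
      by_cases ha : 5 * M / 2 ≤ ‖y‖
      · by_cases hb : ‖y‖ ≤ 7 * M / 2
        · exact Or.inl ⟨ha, hb⟩
        · exact Or.inr (Or.inr ⟨by linarith, h2⟩)
      · exact Or.inr (Or.inl ⟨h1, by linarith⟩)
    · rintro (⟨h1, h2⟩ | ⟨h1, h2⟩ | ⟨h1, h2⟩)
      · exact ⟨by linarith, by linarith⟩
      · exact ⟨h1, by linarith⟩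
      · exact ⟨by linarith, h2⟩
  · intro y hy
    simp only [Set.mem_union, Set.mem_setOf_eq] at hy ⊢
    by_cases h1 : ‖y‖ < 2 * M + η
    · exact Or.inl ⟨hy.1, h1⟩
    · push Not at h1
      by_cases h2 : 5 * M / 2 ≤ ‖y‖
      · by_cases h3 : ‖y‖ ≤ 7 * M / 2
        · exact Or.inr (Or.inr ⟨h2, h3⟩)
        · exact Or.inr (Or.inl ⟨h1, hy.2, Or.inr (by linarith)⟩)
      · exact Or.inr (Or.inl ⟨h1, hy.2, Or.inl (by linarith)⟩)

end Summit.FinalStateConjecture.FinalStateConjecture.Theorems
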